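import Summits.AtomisticToContinuum.HydrodynamicLimit.Theorems.CollisionIsometryCLTDiffuseBackwardInfluenceDefs
import Summits.AtomisticToContinuum.HydrodynamicLimit.Theorems.JParityClosureOddContactSymmetryGibbsInvariance
import Summits.AtomisticToContinuum.HydrodynamicLimit.Theorems.JParityClosureCollisionTightnessDomination

/-!
# `CollisionIsometryCLT.DiffuseBackwardInfluence` (stmt-AtomisticToContinuum-12950), line
# `share-nondegeneracy-one-flight`: the entropy transfer in probability form (`stub_entropyTransfer`)

Registered stub `stub_entropyTransfer` of the lead's skeleton: for continuous profiles `a₀, θ₀ > 0`, `u₀`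
there are `σₑ > 0` and, for every `0 < σ < σₑ`, a reference temperature `θ > 0` and a budget constant
`C ≥ 0` with `EntropyTransferAt σ θ C a₀ θ₀ u₀` (vocabulary of
`CollisionIsometryCLTDiffuseBackwardInfluenceDefs`): events `B_N` with `G_N(B_N) ≤ e^{-h(N+1)}` eventually,
at a rate `h > C`, under the INVARIANT homogeneous law `G_N = eqLaw σ θ N` are negligible along the local
Gibbs law pushed forward by ANY flow times `s_N`.

Proof (the KL-free DENSITY ROUTE; "backwards entropy method" in measure form).

* DOMINATION (landed, `exists_localGibbsMeasure_le_smul_const`): for `θ = 2 sup θ₀` there is `Λ ≥ 1` with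
  `localGibbsMeasure σ a₀ u₀ θ₀ N ≤ Λ^{N+1} • localGibbsMeasure σ 1 0 θ N` for all `σ ≤ 1/2` and all `N`
  (pointwise comparison of the canonical densities: bounded one-particle ratio by completing the square,
  partition functions `Z(a₀) ≥ (inf a₀)^{N+1} Z(1) > 0`). We take `σₑ = 1/2`, `C = log Λ`.
* INVARIANCE (landed, `measurePreserving_flow_localGibbsLaw_const` = the support item `GibbsInvariance`):
  every flow map `Φ_s` preserves `eqLaw σ θ N Φ`, so `G_N(Φ_s⁻¹ B) ≤ ((Φ_s)_# G_N)(B) = G_N(B)` for EVERY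
  set `B` (`Measure.le_map_apply`; no measurability of `B` is needed).
* ASSEMBLY: `P_N(Φ_s⁻¹ B_N) ≤ Λ^{N+1} G_N(Φ_s⁻¹ B_N) ≤ Λ^{N+1} G_N(B_N) ≤ e^{(log Λ - h)(N+1)} → 0`.

References: H. Spohn, *Large Scale Dynamics of Interacting Particles* (1991), Part I §2.3–§3 (local
equilibrium, relative entropy of order `N`); C. Kipnis, C. Landim, *Scaling Limits of Interacting Particle
Systems* (1999), App. 1.8 (the entropy inequality this measure-form comparison replaces).
-/

namespace Summit.AtomisticToContinuum.HydrodynamicLimit.Theorems.DiffuseBackwardInfluenceShare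

open scoped BigOperators Topology ENNReal
open Filter Set MeasureTheory
open Literature.Analysis.FluidPDE (Config HardSphereFlow)
open Literature.MathematicalPhysics.KineticTheory (localGibbsLaw hsDiameter localGibbsMeasure
  localGibbsLaw_eq)
open Summit.AtomisticToContinuum.HydrodynamicLimit.Theorems.DiffuseBackwardInfluenceNeg

namespace EntropyTransfer

/-- **Invariance of the homogeneous reference law** (`GibbsInvariance`, stmt-AtomisticToContinuum-9239, in
the vocabulary of the line): every hard-sphere flow map `Φ_t` preserves `eqLaw σ θ N Φ` (Liouville's
theorem plus conservation of the kinetic energy on the conull invariant good set;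
`measurePreserving_flow_localGibbsLaw_const`). [folklore] -/
theorem measurePreserving_flow_eqLaw (σ θ : ℝ) (N : ℕ) (Φ : Flow σ N) (t : ℝ) :
    MeasurePreserving (Φ.flow t) (eqLaw σ θ N Φ) (eqLaw σ θ N Φ) :=
  measurePreserving_flow_localGibbsLaw_const σ 1 θ 0 N Φ t

/-- Along the INVARIANT law, flowing an arbitrary event backwards does not increase its probability:
`G_N(Φ_t⁻¹ B) ≤ G_N(B)` for EVERY set `B` (equality for measurable `B`; in general
`G_N(Φ_t⁻¹ B) ≤ ((Φ_t)_# G_N)(B) = G_N(B)` through the measurable hull). [folklore] -/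
theorem eqLaw_preimage_flow_le (σ θ : ℝ) (N : ℕ) (Φ : Flow σ N) (t : ℝ) (B : Set (Cfg N)) :
    eqLaw σ θ N Φ (Φ.flow t ⁻¹' B) ≤ eqLaw σ θ N Φ B := by
  calc eqLaw σ θ N Φ (Φ.flow t ⁻¹' B) ≤ (eqLaw σ θ N Φ).map (Φ.flow t) B :=
        Measure.le_map_apply (Φ.measurable_flow t).aemeasurable B
    _ = eqLaw σ θ N Φ B := by rw [(measurePreserving_flow_eqLaw σ θ N Φ t).map_eq]

/-- **Domination of the local Gibbs law by the homogeneous reference law, on every set**: for continuous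
profiles `a₀, θ₀ > 0`, `u₀` there are `θ > 0` and `C ≥ 0` with
`localGibbsLaw σ a₀ u₀ θ₀ N Φ A ≤ e^{C(N+1)} · eqLaw σ θ N Φ A` for every `σ ≤ 1/2`, every `N`, every flow
and every set `A` (`exists_localGibbsMeasure_le_smul_const` with `C = log Λ`). [folklore] -/
theorem exists_localGibbsLaw_le_exp_mul_eqLaw {a₀ θ₀ : T3 → ℝ} {u₀ : T3 → V3} (ha : Continuous a₀)
    (hθ : Continuous θ₀) (hu : Continuous u₀) (ha0 : ∀ x, 0 < a₀ x) (hθ0 : ∀ x, 0 < θ₀ x) :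
    ∃ θ : ℝ, 0 < θ ∧ ∃ C : ℝ, 0 ≤ C ∧ ∀ σ : ℝ, σ ≤ 1 / 2 →
      ∀ (N : ℕ) (Φ : Flow σ N) (A : Set (Cfg N)),
        localGibbsLaw σ a₀ u₀ θ₀ N Φ A ≤
          ENNReal.ofReal (Real.exp (C * ((N : ℝ) + 1))) * eqLaw σ θ N Φ A := by
  obtain ⟨θ, hθpos, Λ, hΛ, hdom⟩ := exists_localGibbsMeasure_le_smul_const ha hθ hu ha0 hθ0
  have hΛ0 : 0 < Λ := one_pos.trans_le hΛ
  refine ⟨θ, hθpos, Real.log Λ, Real.log_nonneg hΛ, fun σ hσ N Φ A => ?_⟩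
  have hexp : Real.exp (Real.log Λ * ((N : ℝ) + 1)) = Λ ^ (N + 1) := by
    rw [show Real.log Λ * ((N : ℝ) + 1) = ((N + 1 : ℕ) : ℝ) * Real.log Λ by push_cast; ring,
      Real.exp_nat_mul, Real.exp_log hΛ0]
  calc localGibbsLaw σ a₀ u₀ θ₀ N Φ A
      = localGibbsMeasure σ a₀ u₀ θ₀ N A := by rw [localGibbsLaw_eq]
    _ ≤ (ENNReal.ofReal (Λ ^ (N + 1)) •
          localGibbsMeasure σ (fun _ => 1) (fun _ => (0 : V3)) (fun _ => θ) N) A :=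
        Measure.le_iff'.1 (hdom σ hσ N) A
    _ = ENNReal.ofReal (Real.exp (Real.log Λ * ((N : ℝ) + 1))) * eqLaw σ θ N Φ A := by
        rw [Measure.smul_apply, smul_eq_mul, hexp, eqLaw, localGibbsLaw_eq]

/-- `e^{-κ(N+1)} → 0` for `κ > 0`, in the form used: eventually `e^{(C - h)(N+1)} ≤ ε` when `C < h`.
[folklore] -/
theorem eventually_exp_mul_le {C h ε : ℝ} (hCh : C < h) (hε : 0 < ε) :
    ∀ᶠ N : ℕ in atTop, Real.exp ((C - h) * ((N : ℝ) + 1)) ≤ ε := by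
  have h1 : Tendsto (fun N : ℕ => (N : ℝ) + 1) atTop atTop :=
    tendsto_atTop_add_const_right _ _ tendsto_natCast_atTop_atTop
  have h2 : Tendsto (fun N : ℕ => (C - h) * ((N : ℝ) + 1)) atTop atBot :=
    h1.const_mul_atTop_of_neg (sub_neg.2 hCh)
  exact (Real.tendsto_exp_atBot.comp h2).eventually (eventually_le_nhds hε)

end EntropyTransfer

open EntropyTransfer in
/-- **STUB `stub_entropyTransfer` (registered; line `share-nondegeneracy-one-flight` of crux
stmt-AtomisticToContinuum-12950) — the entropy transfer in probability form.** For continuous profiles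
`a₀, θ₀ > 0`, `u₀` take `σₑ = 1/2`, the reference temperature `θ = 2 sup θ₀` and the budget constant
`C = log Λ ≥ 0` of the domination `localGibbsLaw ≤ Λ^{N+1} eqLaw θ`: if `G_N(B_N) ≤ e^{-h(N+1)}` eventually
at a rate `h > C`, then for all flow times `s_N`,
`P_N(Φ_{s_N} ∈ B_N) ≤ Λ^{N+1} G_N(Φ_{s_N}⁻¹ B_N) ≤ Λ^{N+1} G_N(B_N) ≤ e^{(C-h)(N+1)} ≤ ε` eventually
(domination on every set, invariance of `G_N` under `Φ_{s_N}`). [folklore] -/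
theorem stub_entropyTransfer : ∀ (a₀ θ₀ : T3 → ℝ) (u₀ : T3 → V3), Continuous a₀ → Continuous θ₀ → Continuous u₀ → (∀ x, 0 < a₀ x) → (∀ x, 0 < θ₀ x) → ∃ σₑ : ℝ, 0 < σₑ ∧ ∀ σ : ℝ, 0 < σ → σ < σₑ → ∃ θ : ℝ, 0 < θ ∧ ∃ C : ℝ, 0 ≤ C ∧ EntropyTransferAt σ θ C a₀ θ₀ u₀ := by
  intro a₀ θ₀ u₀ ha hθ hu ha0 hθ0
  obtain ⟨θ, hθpos, C, hC0, hle⟩ := exists_localGibbsLaw_le_exp_mul_eqLaw ha hθ hu ha0 hθ0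
  refine ⟨1 / 2, one_half_pos, fun σ _ hσ => ⟨θ, hθpos, C, hC0, ?_⟩⟩
  intro Φ B h hCh hG s ε hε
  filter_upwards [hG, eventually_exp_mul_le hCh hε] with N hGN hεN
  calc localGibbsLaw σ a₀ u₀ θ₀ N (Φ N) ((Φ N).flow (s N) ⁻¹' B N)
      ≤ ENNReal.ofReal (Real.exp (C * ((N : ℝ) + 1))) *
          eqLaw σ θ N (Φ N) ((Φ N).flow (s N) ⁻¹' B N) := hle σ hσ.le N (Φ N) _
    _ ≤ ENNReal.ofReal (Real.exp (C * ((N : ℝ) + 1))) * eqLaw σ θ N (Φ N) (B N) :=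
        mul_le_mul_right (eqLaw_preimage_flow_le σ θ N (Φ N) (s N) (B N)) _
    _ ≤ ENNReal.ofReal (Real.exp (C * ((N : ℝ) + 1))) *
          ENNReal.ofReal (Real.exp (-(h * ((N : ℝ) + 1)))) := mul_le_mul_right hGN _
    _ = ENNReal.ofReal (Real.exp ((C - h) * ((N : ℝ) + 1))) := by
        rw [← ENNReal.ofReal_mul (Real.exp_pos _).le, ← Real.exp_add]
        congr 2
        ring
    _ ≤ ENNReal.ofReal ε := ENNReal.ofReal_le_ofReal hεN

end Summit.AtomisticToContinuum.HydrodynamicLimit.Theorems.DiffuseBackwardInfluenceShare
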